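/- Copyright: the b2b-balaban cell (near-miss cell 7), T⁴-continuum fan-out; row NE7b CRUX team (2), the row OWNER
`t4-ne7b-p1` (gen 49) — RULING R-OWNER-49-1 «ORDER OF ATTACK (3) → (4) → (2); (3) FIRST: THE FIBRE RESUMMATION LEMMA»
((α)-M5-5, row S25; answers the refuter's PRICING-NE7b v17 ask A-v17-1).  Released under the licence of the surrounding
project. -/
import Summits.QuantumFields.BalabanUV.T4Continuum.Support.HistoryPriceKeys

/-!
# (α)-M5-5 «THE FIBRE RESUMMATION LEMMA»: the located display (ρ) `FibreMass` of row NE7b from three primitive inputs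

Summits-side support leaf of the T⁴-continuum cell (rung (B)+1 on a FINITE torus only; NOT infinite volume, NOT the
mass gap, NOT the Clay statement; NOT a proof of the spine estimate NE7b — the cell's OWN estimate, NOT PRINTED, NOT
PROVED).  [folklore] finite combinatorics + real arithmetic over the lineage's key letters (`HistoryPriceKeys.MULTOf`,
`HistoryPriceNodeSum.nsum`) and the fibre of a class map (`T4LiveClassFibration.fibre`); no `structure`, no `[cite:]`
tag, nothing printed asserted, no `Prop` fact minted, zero `sorry`.  B16 = [Balaban1989LargeFieldII] pp. 378–390 is a
manuscript UNDER AUDIT; p. 383's sentence «the summations over the admissible sequences can be replaced by the factors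
exp O(1)(MR_j)^{−d}|Z_j|» and (1.71)∕(1.72) pp. 378–379, (1.97)–(1.100) pp. 388–390 are quoted as LOCATORS only.

WHY.  After THE GUARDED CUT (R-OWNER-48-1) the (α) assembly's terminal theorem
`HistoryRealiseCellsRunAssemblyWTVSL.continuumYM4Torus_of_histReadingL_fsc` reads ONE hypothesis record `HistReadDataL`;
the refuter's PRICING-NE7b v17 F94 lists what that record still READS, and names as NE7b's OWN residual — NOT-IN-PRINT,
«the crux» — the VOLUME-TYPE display (ρ) `FibreMass` (field `hρ`; R-OWNER-46-1 (c)):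
`Σ_{τ ∈ fibre k} DEAD(τ)·|wC(τ)|·e^{BV(τ)} ≤ W K · MULTOf (sharpT (φB K) (φR K)) k` for every bad key class `k` —
«the histories sharing one physical live family resum, beyond the key, to a per-event volume factor».  Ask A-v17-1: name
the order of attack among F94 (2)∕(3)∕(4).  RULING R-OWNER-49-1 takes (3) FIRST and puts its COMBINATORIAL CORE in the
kernel: (ρ) is the conclusion of an abstract product-gas bound over the finite key from three PRIMITIVE inputs —
(ρ1) an INJECTIVE DECORATION of the key fibre: every term `τ` of the fibre is determined by one slice index `slice τ`
(the curly summand) and, for every member `w ∈ k`, a decoration `dec τ w ∈ Dec w` (the admissible sub-sequence data of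
that member beyond the key — (1.71)'s `{Ω^c_j ∩ X, Z_j ∩ X}_j, r`);
(ρ2) the WEIGHT FACTORISATION `dmass τ ≤ v (slice τ) · ∏_{w ∈ k} u w (dec τ w)` with a slice envelope `Σ_c v c ≤ W`
(the curly normalisation (1.97)–(1.100) and the last-exponent envelope);
(ρ3) the PER-MEMBER DECORATION MASS `Σ_{x ∈ Dec w} u w x ≤ exp (nsum φ w.2.1)` (print's p. 383 sentence, per member:
the number of admissible sub-sequences, weighted, is a per-event volume factor).
Then `Σ_{τ ∈ fibre k} dmass τ ≤ W · ∏_{w ∈ k} Σ_{x ∈ Dec w} u w x ≤ W · MULTOf φ k` — finite combinatorics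
(`Fintype.piFinset` ∕ `Finset.prod_univ_sum` over `↥k`, re-indexing along the injective decoration, slicing by
`Finset.sum_fiberwise_of_maps_to`).  The COUNTING INSTANCE of (ρ3) is print's sentence AS A THEOREM with the O(1)
explicit: the sub-unions of an `n`-cube set number `2^n = exp (n·log 2)`, pairs of them `4^n`, and along a genealogy the
product of per-node counts `N e ≤ exp (φ e)` is at most `exp (nsum φ G)` (`ncount_le_exp_nsum`).

WHAT.  §1 `prod_sum_eq_sum_piFinset` (the product of the per-member sums is the sum over all decorations),
**`sum_le_mul_prod_sum_of_decor`** (basic form: one envelope constant `E`), **`sum_le_mul_prod_sum_of_sliced_decor`**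
(with the slice).  §2 `prod_sum_le_exp_sum`, **`prod_sum_le_MULTOf`** (per-member masses `≤ exp (nsum φ w.2.1)` ⇒ the
product is at most `MULTOf φ k`).  §3 **`fibreMass_of_decoration`** — THE JUNCTION: conclusion LITERALLY the shape of
`HistReadDataL.hρ` at a cutoff, `∑ τ ∈ fibre kmem T K k, dmass τ ≤ W * MULTOf φ k`, for ANY `dmass` (in particular the
custodian's `dmassOf ℛ Φf t`), from (ρ1)(ρ2)(ρ3); `card_fibre_le_of_decoration` (the pure count).  §4 THE COUNTING
INSTANCE: `sum_one_powerset_eq`, `card_powerset_prod_powerset`, `two_pow_le_exp`, `four_pow_le_exp`, `ncount`,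
**`ncount_le_exp_nsum`**, `prod_pow_le_exp_sum`.  §5 a decided toy (four terms over a one-member key with a binary
decoration and a binary slice: `4 ≤ 2·2`, tight).

HONEST SCOPE.  Bookkeeping.  The three inputs (ρ1)(ρ2)(ρ3) are HYPOTHESIS SHAPES: (ρ1) is an INDEX READING of the same
class as `HistRead` («a term of the key fibre IS (key, per-member sub-sequence data, curly summand)» — true by inspection
once (1.72)'s index is Bałaban's, nothing to prove before); (ρ2) is the envelope reading (PARAMETRIC citation of
(1.97)–(1.100)); (ρ3) is KERNEL for cube-subset decorations (§4) at a share `φ e ≥ ncubes e · log 4` — whether the booked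
share `φB K j d′` of `RoundingRoomF` affords `log 4` per cube is a NEEDS-CONSTANT check (refuter ∕ balaban-calc), not
decided here.  BY-NAME EFFECT ON THE WALL: §2 row `resum`'s display (ρ) becomes «K modulo (ρ1) + (ρ2) + the share
check» once the crew instantiates `Dec`∕`dec`∕`slice` on `HistReading`'s carriers (INTERFACE REQUEST IR-49-1); until
then (ρ) stays the field `hρ` and this file is its SPEC in the kernel.  NE7b NOT PRINTED ∕ NOT PROVED; spine 0∕9.
HONEST DEPENDENCY (cell): continuum YM on T⁴ ⇐ BetaPertH ∧ nine spine estimates (0/9 proved); BetaPertH ⇐ (D1) ∧ (D4)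
∧ CAP+tail; G-an2-4 gates asym, D1 and NE2/3/4.  This file changes none of it.
-/

open Finset
open Literature.MathematicalPhysics.QuantumFieldTheory.Balaban1983to89
open T4PersistenceDictionary T4LiveClassFibration
open Summit.QuantumFields.BalabanUV.T4Continuum.HistoryPriceNodeSum
open Summit.QuantumFields.BalabanUV.T4Continuum.HistoryPriceKeys

namespace Summit.QuantumFields.BalabanUV.T4Continuum.HistoryBankingFibreResum

noncomputable section

/-! ## §1 The abstract product-gas bound over a finite key -/

section Abstract

variable {ι ω δ : Type*}

/-- the restriction of a term's decoration to the key, as a function on the key's subtype [folklore] -/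
def resK (k : Finset ω) (dec : ι → ω → δ) (τ : ι) : ↥k → δ := fun w => dec τ w

/-- the value of the restricted decoration at a member [folklore] -/
@[simp] theorem resK_apply (k : Finset ω) (dec : ι → ω → δ) (τ : ι) (w : ↥k) : resK k dec τ w = dec τ w := rfl

/-- a decoration with values in the displayed decoration sets restricts to a member of the product set [folklore] -/
theorem resK_mem_piFinset [DecidableEq ω] {k : Finset ω} {Dec : ω → Finset δ} {dec : ι → ω → δ} {τ : ι}
    (h : ∀ w ∈ k, dec τ w ∈ Dec w) : resK k dec τ ∈ Fintype.piFinset (fun w : ↥k => Dec w) :=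
  Fintype.mem_piFinset.2 fun w => h w w.2

/-- two terms with the same restricted decoration have the same decoration at every member of the key [folklore] -/
theorem dec_eq_of_resK_eq {k : Finset ω} {dec : ι → ω → δ} {τ τ' : ι} (h : resK k dec τ = resK k dec τ') :
    ∀ w ∈ k, dec τ w = dec τ' w := fun w hw => by
  have := congrFun h ⟨w, hw⟩
  simpa only [resK_apply] using this

/-- **THE PRODUCT OF THE PER-MEMBER DECORATION SUMS IS THE SUM OVER ALL DECORATIONS OF THE PRODUCT** (distributivity over
the finite key, `Finset.prod_univ_sum` on the key's subtype). [folklore] -/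
theorem prod_sum_eq_sum_piFinset [DecidableEq ω] (k : Finset ω) (Dec : ω → Finset δ) (u : ω → δ → ℝ) :
    ∏ w ∈ k, ∑ x ∈ Dec w, u w x = ∑ f ∈ Fintype.piFinset (fun w : ↥k => Dec w), ∏ w : ↥k, u w (f w) := by
  rw [← Finset.prod_coe_sort k, Finset.prod_univ_sum]

/-- **THE FIBRE RESUMMATION LEMMA, BASIC FORM.**  A finite set of terms `S`, a finite key `k`, per-member decoration
sets `Dec w` and a decoration `dec τ w ∈ Dec w` of every term at every member which DETERMINES the term (injective on
`S`); weights factorised as `w τ ≤ E · ∏_{w ∈ k} u w (dec τ w)` with `E ≥ 0`, `u ≥ 0` on the decoration sets.  Then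
`Σ_{τ ∈ S} w τ ≤ E · ∏_{w ∈ k} Σ_{x ∈ Dec w} u w x` — re-index along the injective decoration into the product set and
distribute. [folklore] -/
theorem sum_le_mul_prod_sum_of_decor (S : Finset ι) (k : Finset ω) (Dec : ω → Finset δ) (dec : ι → ω → δ)
    {w : ι → ℝ} {E : ℝ} (hE : 0 ≤ E) {u : ω → δ → ℝ} (hu : ∀ b ∈ k, ∀ x ∈ Dec b, 0 ≤ u b x)
    (hmem : ∀ τ ∈ S, ∀ b ∈ k, dec τ b ∈ Dec b)
    (hinj : ∀ τ ∈ S, ∀ τ' ∈ S, (∀ b ∈ k, dec τ b = dec τ' b) → τ = τ')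
    (hw : ∀ τ ∈ S, w τ ≤ E * ∏ b ∈ k, u b (dec τ b)) :
    ∑ τ ∈ S, w τ ≤ E * ∏ b ∈ k, ∑ x ∈ Dec b, u b x := by
  classical
  have h1 : ∑ τ ∈ S, w τ ≤ ∑ τ ∈ S, E * ∏ b : ↥k, u b (resK k dec τ b) := by
    refine Finset.sum_le_sum fun τ hτ => ?_
    have h := hw τ hτ
    rw [← Finset.prod_coe_sort k] at h
    exact h
  have hinj' : Set.InjOn (resK k dec) ↑S := fun τ hτ τ' hτ' h =>
    hinj τ (Finset.mem_coe.1 hτ) τ' (Finset.mem_coe.1 hτ') (dec_eq_of_resK_eq h)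
  have h2 : ∑ τ ∈ S, E * ∏ b : ↥k, u b (resK k dec τ b) =
      ∑ f ∈ S.image (resK k dec), E * ∏ b : ↥k, u b (f b) := by
    rw [Finset.sum_image hinj']
  have hsub : S.image (resK k dec) ⊆ Fintype.piFinset (fun w : ↥k => Dec w) := by
    intro f hf
    obtain ⟨τ, hτ, rfl⟩ := Finset.mem_image.1 hf
    exact resK_mem_piFinset (hmem τ hτ)
  have h3 : ∑ f ∈ S.image (resK k dec), E * ∏ b : ↥k, u b (f b) ≤
      ∑ f ∈ Fintype.piFinset (fun w : ↥k => Dec w), E * ∏ b : ↥k, u b (f b) := by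
    refine Finset.sum_le_sum_of_subset_of_nonneg hsub fun f hf _ => ?_
    exact mul_nonneg hE (Finset.prod_nonneg fun b _ => hu b b.2 _ (Fintype.mem_piFinset.1 hf b))
  calc ∑ τ ∈ S, w τ ≤ ∑ τ ∈ S, E * ∏ b : ↥k, u b (resK k dec τ b) := h1
    _ = ∑ f ∈ S.image (resK k dec), E * ∏ b : ↥k, u b (f b) := h2
    _ ≤ ∑ f ∈ Fintype.piFinset (fun w : ↥k => Dec w), E * ∏ b : ↥k, u b (f b) := h3
    _ = E * ∏ b ∈ k, ∑ x ∈ Dec b, u b x := by rw [← Finset.mul_sum, prod_sum_eq_sum_piFinset]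

/-- **THE FIBRE RESUMMATION LEMMA, SLICED FORM.**  As the basic form, with one more index `slice τ ∈ Csl` (the curly
summand of the term) carrying its own nonnegative envelope `v` with `Σ_{c ∈ Csl} v c ≤ W`; the decoration together with
the slice determines the term; weights `w τ ≤ v (slice τ) · ∏_{w ∈ k} u w (dec τ w)`.  Then
`Σ_{τ ∈ S} w τ ≤ W · ∏_{w ∈ k} Σ_{x ∈ Dec w} u w x` (slice by `Finset.sum_fiberwise_of_maps_to`, the basic form on each
slice, then the slice envelope). [folklore] -/
theorem sum_le_mul_prod_sum_of_sliced_decor {κ : Type*} (S : Finset ι) (k : Finset ω) (Dec : ω → Finset δ)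
    (dec : ι → ω → δ) (Csl : Finset κ) (slice : ι → κ) {v : κ → ℝ} (hv : ∀ c ∈ Csl, 0 ≤ v c) {W : ℝ}
    (hW : ∑ c ∈ Csl, v c ≤ W) {w : ι → ℝ} {u : ω → δ → ℝ} (hu : ∀ b ∈ k, ∀ x ∈ Dec b, 0 ≤ u b x)
    (hsl : ∀ τ ∈ S, slice τ ∈ Csl) (hmem : ∀ τ ∈ S, ∀ b ∈ k, dec τ b ∈ Dec b)
    (hinj : ∀ τ ∈ S, ∀ τ' ∈ S, slice τ = slice τ' → (∀ b ∈ k, dec τ b = dec τ' b) → τ = τ')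
    (hw : ∀ τ ∈ S, w τ ≤ v (slice τ) * ∏ b ∈ k, u b (dec τ b)) :
    ∑ τ ∈ S, w τ ≤ W * ∏ b ∈ k, ∑ x ∈ Dec b, u b x := by
  classical
  have hP : 0 ≤ ∏ b ∈ k, ∑ x ∈ Dec b, u b x := Finset.prod_nonneg fun b hb => Finset.sum_nonneg (hu b hb)
  rw [← Finset.sum_fiberwise_of_maps_to hsl]
  have hc : ∀ c ∈ Csl, ∑ τ ∈ S with slice τ = c, w τ ≤ v c * ∏ b ∈ k, ∑ x ∈ Dec b, u b x := by
    intro c hc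
    refine sum_le_mul_prod_sum_of_decor _ k Dec dec (hv c hc) hu ?_ ?_ ?_
    · exact fun τ hτ => hmem τ (Finset.mem_filter.1 hτ).1
    · intro τ hτ τ' hτ' h
      have h1 := Finset.mem_filter.1 hτ
      have h2 := Finset.mem_filter.1 hτ'
      exact hinj τ h1.1 τ' h2.1 (h1.2.trans h2.2.symm) h
    · intro τ hτ
      have h1 := Finset.mem_filter.1 hτ
      rw [← h1.2]
      exact hw τ h1.1
  calc ∑ c ∈ Csl, ∑ τ ∈ S with slice τ = c, w τ ≤ ∑ c ∈ Csl, v c * ∏ b ∈ k, ∑ x ∈ Dec b, u b x :=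
        Finset.sum_le_sum hc
    _ = (∑ c ∈ Csl, v c) * ∏ b ∈ k, ∑ x ∈ Dec b, u b x := by rw [Finset.sum_mul]
    _ ≤ W * ∏ b ∈ k, ∑ x ∈ Dec b, u b x := mul_le_mul_of_nonneg_right hW hP

/-- **THE PURE COUNT**: if the decoration determines the term, the fibre has at most `∏_{w ∈ k} #(Dec w)` terms.
[folklore] -/
theorem card_le_prod_card_of_decor (S : Finset ι) (k : Finset ω) (Dec : ω → Finset δ) (dec : ι → ω → δ)
    (hmem : ∀ τ ∈ S, ∀ b ∈ k, dec τ b ∈ Dec b)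
    (hinj : ∀ τ ∈ S, ∀ τ' ∈ S, (∀ b ∈ k, dec τ b = dec τ' b) → τ = τ') :
    (S.card : ℝ) ≤ ∏ b ∈ k, ((Dec b).card : ℝ) := by
  have h := sum_le_mul_prod_sum_of_decor S k Dec dec (w := fun _ => (1 : ℝ)) (E := 1) zero_le_one
    (u := fun _ _ => (1 : ℝ)) (fun _ _ _ _ => zero_le_one) hmem hinj (fun _ _ => by simp)
  simpa using h

end Abstract

/-! ## §2 The per-member masses against the key letter `MULTOf` -/

section Mult

variable {ω δ : Type*}

/-- per-member masses at most `exp (m w)` multiply to at most `exp (Σ m)`. [folklore] -/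
theorem prod_sum_le_exp_sum (k : Finset ω) (Dec : ω → Finset δ) {u : ω → δ → ℝ}
    (hu : ∀ b ∈ k, ∀ x ∈ Dec b, 0 ≤ u b x) {m : ω → ℝ} (hm : ∀ b ∈ k, ∑ x ∈ Dec b, u b x ≤ Real.exp (m b)) :
    ∏ b ∈ k, ∑ x ∈ Dec b, u b x ≤ Real.exp (∑ b ∈ k, m b) := by
  rw [Real.exp_sum]
  exact Finset.prod_le_prod (fun b hb => Finset.sum_nonneg (hu b hb)) hm

variable {γ δ' : Type*}

/-- **PER-MEMBER DECORATION MASSES `≤ exp (nsum φ w.2.1)` MULTIPLY TO AT MOST THE KEY LETTER `MULTOf φ k`** (the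
fibre multiplicity of R-OWNER-46-1, `∏_{w ∈ k} exp (nsum φ w.2.1)`, BY NAME). [folklore] -/
theorem prod_sum_le_MULTOf (φ : PEv → ℝ) (k : Finset (γ × Gen PEv × δ')) (Dec : γ × Gen PEv × δ' → Finset δ)
    {u : γ × Gen PEv × δ' → δ → ℝ} (hu : ∀ w ∈ k, ∀ x ∈ Dec w, 0 ≤ u w x)
    (hm : ∀ w ∈ k, ∑ x ∈ Dec w, u w x ≤ Real.exp (nsum φ w.2.1)) :
    ∏ w ∈ k, ∑ x ∈ Dec w, u w x ≤ MULTOf φ k := by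
  unfold MULTOf
  exact Finset.prod_le_prod (fun w hw => Finset.sum_nonneg (hu w hw)) hm

/-- the pure count against the key letter: `∏_{w ∈ k} #(Dec w) ≤ MULTOf φ k` when `#(Dec w) ≤ exp (nsum φ w.2.1)`.
[folklore] -/
theorem prod_card_le_MULTOf (φ : PEv → ℝ) (k : Finset (γ × Gen PEv × δ')) (Dec : γ × Gen PEv × δ' → Finset δ)
    (hm : ∀ w ∈ k, ((Dec w).card : ℝ) ≤ Real.exp (nsum φ w.2.1)) :
    ∏ w ∈ k, ((Dec w).card : ℝ) ≤ MULTOf φ k := by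
  unfold MULTOf
  exact Finset.prod_le_prod (fun w _ => Nat.cast_nonneg _) hm

end Mult

/-! ## §3 THE JUNCTION: the display (ρ) `FibreMass` from an injective decoration of the key fibre -/

section Junction

variable {ι γ δ' δ κ : Type*} [DecidableEq γ] [DecidableEq δ']

/-- **(ρ) `FibreMass` FROM (ρ1) + (ρ2) + (ρ3)** — conclusion LITERALLY the shape of the field `HistReadDataL.hρ` at one
cutoff `K` and one key class `k`, for ANY per-term mass `dmass` (the custodian's `dmassOf ℛ Φf t` in the record):
* (ρ1) DECORATION: a slice `slice τ ∈ Csl` and, for every member `w ∈ k`, a decoration `dec τ w ∈ Dec w`, jointly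
  INJECTIVE on the key fibre `fibre kmem T K k`;
* (ρ2) FACTORISATION: `dmass τ ≤ v (slice τ) · ∏_{w ∈ k} u w (dec τ w)` on the fibre, `u, v ≥ 0`, slice envelope
  `Σ_{c ∈ Csl} v c ≤ W`;
* (ρ3) PER-MEMBER MASS: `Σ_{x ∈ Dec w} u w x ≤ exp (nsum φ w.2.1)` for `w ∈ k`.
Then `∑ τ ∈ fibre kmem T K k, dmass τ ≤ W * MULTOf φ k`. [folklore] -/
theorem fibreMass_of_decoration (kmem : ℕ → ι → Finset (γ × Gen PEv × δ')) (T : ℕ → Finset ι) (K : ℕ)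
    (k : Finset (γ × Gen PEv × δ')) (dmass : ι → ℝ) (φ : PEv → ℝ) {W : ℝ}
    (Dec : γ × Gen PEv × δ' → Finset δ) (dec : ι → γ × Gen PEv × δ' → δ) (Csl : Finset κ) (slice : ι → κ)
    {v : κ → ℝ} (hv : ∀ c ∈ Csl, 0 ≤ v c) (hW : ∑ c ∈ Csl, v c ≤ W)
    {u : γ × Gen PEv × δ' → δ → ℝ} (hu : ∀ w ∈ k, ∀ x ∈ Dec w, 0 ≤ u w x)
    (hsl : ∀ τ ∈ fibre kmem T K k, slice τ ∈ Csl)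
    (hmem : ∀ τ ∈ fibre kmem T K k, ∀ w ∈ k, dec τ w ∈ Dec w)
    (hinj : ∀ τ ∈ fibre kmem T K k, ∀ τ' ∈ fibre kmem T K k,
      slice τ = slice τ' → (∀ w ∈ k, dec τ w = dec τ' w) → τ = τ')
    (hfac : ∀ τ ∈ fibre kmem T K k, dmass τ ≤ v (slice τ) * ∏ w ∈ k, u w (dec τ w))
    (hmass : ∀ w ∈ k, ∑ x ∈ Dec w, u w x ≤ Real.exp (nsum φ w.2.1)) :
    ∑ τ ∈ fibre kmem T K k, dmass τ ≤ W * MULTOf φ k := by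
  have hW0 : 0 ≤ W := (Finset.sum_nonneg hv).trans hW
  calc ∑ τ ∈ fibre kmem T K k, dmass τ ≤ W * ∏ w ∈ k, ∑ x ∈ Dec w, u w x :=
      sum_le_mul_prod_sum_of_sliced_decor _ k Dec dec Csl slice hv hW hu hsl hmem hinj hfac
    _ ≤ W * MULTOf φ k := mul_le_mul_of_nonneg_left (prod_sum_le_MULTOf φ k Dec hu hmass) hW0

/-- **(ρ) OVER EVERY BAD KEY CLASS** — the field shape with its outer quantifier `∀ k ∈ Bad, …` (any finite family of
classes, e.g. `badGMems …`), from decoration data supplied class by class. [folklore] -/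
theorem fibreMass_of_decoration_classes (kmem : ℕ → ι → Finset (γ × Gen PEv × δ')) (T : ℕ → Finset ι) (K : ℕ)
    (Bad : Finset (Finset (γ × Gen PEv × δ'))) (dmass : ι → ℝ) (φ : PEv → ℝ) {W : ℝ}
    (Dec : γ × Gen PEv × δ' → Finset δ) (dec : ι → γ × Gen PEv × δ' → δ) (Csl : Finset κ) (slice : ι → κ)
    {v : κ → ℝ} (hv : ∀ c ∈ Csl, 0 ≤ v c) (hW : ∑ c ∈ Csl, v c ≤ W)
    {u : γ × Gen PEv × δ' → δ → ℝ} (hu : ∀ k ∈ Bad, ∀ w ∈ k, ∀ x ∈ Dec w, 0 ≤ u w x)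
    (hsl : ∀ k ∈ Bad, ∀ τ ∈ fibre kmem T K k, slice τ ∈ Csl)
    (hmem : ∀ k ∈ Bad, ∀ τ ∈ fibre kmem T K k, ∀ w ∈ k, dec τ w ∈ Dec w)
    (hinj : ∀ k ∈ Bad, ∀ τ ∈ fibre kmem T K k, ∀ τ' ∈ fibre kmem T K k,
      slice τ = slice τ' → (∀ w ∈ k, dec τ w = dec τ' w) → τ = τ')
    (hfac : ∀ k ∈ Bad, ∀ τ ∈ fibre kmem T K k, dmass τ ≤ v (slice τ) * ∏ w ∈ k, u w (dec τ w))
    (hmass : ∀ k ∈ Bad, ∀ w ∈ k, ∑ x ∈ Dec w, u w x ≤ Real.exp (nsum φ w.2.1)) :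
    ∀ k ∈ Bad, ∑ τ ∈ fibre kmem T K k, dmass τ ≤ W * MULTOf φ k := fun k hk =>
  fibreMass_of_decoration kmem T K k dmass φ Dec dec Csl slice hv hW (hu k hk) (hsl k hk) (hmem k hk) (hinj k hk)
    (hfac k hk) (hmass k hk)

/-- **THE PURE COUNT OF A KEY FIBRE**: with an injective decoration (no slice) the fibre has at most `MULTOf φ k` terms
when every member's decoration set has at most `exp (nsum φ w.2.1)` elements. [folklore] -/
theorem card_fibre_le_of_decoration (kmem : ℕ → ι → Finset (γ × Gen PEv × δ')) (T : ℕ → Finset ι) (K : ℕ)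
    (k : Finset (γ × Gen PEv × δ')) (φ : PEv → ℝ) (Dec : γ × Gen PEv × δ' → Finset δ)
    (dec : ι → γ × Gen PEv × δ' → δ) (hmem : ∀ τ ∈ fibre kmem T K k, ∀ w ∈ k, dec τ w ∈ Dec w)
    (hinj : ∀ τ ∈ fibre kmem T K k, ∀ τ' ∈ fibre kmem T K k, (∀ w ∈ k, dec τ w = dec τ' w) → τ = τ')
    (hcard : ∀ w ∈ k, ((Dec w).card : ℝ) ≤ Real.exp (nsum φ w.2.1)) :
    ((fibre kmem T K k).card : ℝ) ≤ MULTOf φ k :=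
  (card_le_prod_card_of_decor _ k Dec dec hmem hinj).trans (prod_card_le_MULTOf φ k Dec hcard)

end Junction

/-! ## §4 THE COUNTING INSTANCE: print's p. 383 sentence with the O(1) explicit -/

section Counting

variable {α ε : Type*}

/-- the sub-unions of an `n`-cube set, counted with unit weight, number `2^n`. [folklore] -/
theorem sum_one_powerset_eq (s : Finset α) : ∑ _x ∈ s.powerset, (1 : ℝ) = 2 ^ s.card := by
  simp [Finset.card_powerset]

/-- pairs of sub-unions (`Ω^c_j ∩ X`, `Z_j ∩ X` at one step) number `4^n`. [folklore] -/
theorem card_powerset_prod_powerset (s : Finset α) : (s.powerset ×ˢ s.powerset).card = 4 ^ s.card := by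
  rw [Finset.card_product, Finset.card_powerset, ← pow_add, ← two_mul, pow_mul]
  norm_num

/-- `2^n ≤ exp φ` as soon as `n·log 2 ≤ φ`. [folklore] -/
theorem two_pow_le_exp {n : ℕ} {φ : ℝ} (h : (n : ℝ) * Real.log 2 ≤ φ) : (2 : ℝ) ^ n ≤ Real.exp φ := by
  have h2 : (2 : ℝ) ^ n = Real.exp ((n : ℝ) * Real.log 2) := by
    rw [Real.exp_nat_mul, Real.exp_log (by norm_num : (0 : ℝ) < 2)]
  rw [h2]
  exact Real.exp_le_exp.2 h

/-- `4^n ≤ exp φ` as soon as `n·log 4 ≤ φ`. [folklore] -/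
theorem four_pow_le_exp {n : ℕ} {φ : ℝ} (h : (n : ℝ) * Real.log 4 ≤ φ) : (4 : ℝ) ^ n ≤ Real.exp φ := by
  have h4 : (4 : ℝ) ^ n = Real.exp ((n : ℝ) * Real.log 4) := by
    rw [Real.exp_nat_mul, Real.exp_log (by norm_num : (0 : ℝ) < 4)]
  rw [h4]
  exact Real.exp_le_exp.2 h

/-- a general base: `(N : ℝ) ≤ exp φ` from `log N ≤ φ` for a positive count. [folklore] -/
theorem natCast_le_exp_of_log_le {N : ℕ} (hN : 0 < N) {φ : ℝ} (h : Real.log N ≤ φ) : (N : ℝ) ≤ Real.exp φ := by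
  have hN' : (0 : ℝ) < N := by exact_mod_cast hN
  calc (N : ℝ) = Real.exp (Real.log N) := (Real.exp_log hN').symm
    _ ≤ Real.exp φ := Real.exp_le_exp.2 h

/-- **THE NODE COUNT OF A GENEALOGY**: the product over the NODES of a genealogy of a per-event count `N e` (e.g.
`4 ^ ncubes e` admissible choices at a birth, `1` at a renewal or merger) — the same recursion as `nsum`. [folklore] -/
def ncount (N : ε → ℕ) : Gen ε → ℕ
  | Gen.born b _ => N b
  | Gen.renew G e _ => ncount N G * N e
  | Gen.merge X Y e => ncount N X * ncount N Y * N e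

/-- node count of a bare birth [folklore] -/
@[simp] theorem ncount_born (N : ε → ℕ) (b : ε) (j : ℕ) : ncount N (Gen.born b j) = N b := rfl
/-- node count after a renewal [folklore] -/
@[simp] theorem ncount_renew (N : ε → ℕ) (G : Gen ε) (e : ε) (h : ℕ) :
    ncount N (Gen.renew G e h) = ncount N G * N e := rfl
/-- node count after a merger [folklore] -/
@[simp] theorem ncount_merge (N : ε → ℕ) (X Y : Gen ε) (e : ε) :
    ncount N (Gen.merge X Y e) = ncount N X * ncount N Y * N e := rfl

/-- **THE NODE COUNT IS AT MOST `exp` OF THE NODE SUM** when every event's count is at most `exp` of its share: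
`∀ e, N e ≤ exp (φ e)` ⇒ `ncount N G ≤ exp (nsum φ G)` — print's p. 383 sentence along a genealogy («the summations over
the admissible sequences can be replaced by the factors exp O(1)(MR_j)^{−d}|Z_j|», one factor per event). [folklore] -/
theorem ncount_le_exp_nsum (N : ε → ℕ) (φ : ε → ℝ) (h : ∀ e, (N e : ℝ) ≤ Real.exp (φ e)) :
    ∀ G : Gen ε, (ncount N G : ℝ) ≤ Real.exp (nsum φ G)
  | Gen.born b _ => by simpa using h b
  | Gen.renew G e _ => by
    rw [ncount_renew, nsum_renew, Nat.cast_mul, Real.exp_add]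
    exact mul_le_mul (ncount_le_exp_nsum N φ h G) (h e) (Nat.cast_nonneg _) (Real.exp_nonneg _)
  | Gen.merge X Y e => by
    rw [ncount_merge, nsum_merge, Nat.cast_mul, Nat.cast_mul, Real.exp_add, Real.exp_add]
    exact mul_le_mul (mul_le_mul (ncount_le_exp_nsum N φ h X) (ncount_le_exp_nsum N φ h Y) (Nat.cast_nonneg _)
      (Real.exp_nonneg _)) (h e) (Nat.cast_nonneg _) (by positivity)

/-- **THE CUBE-SUBSET SHARE**: with `N e := 4 ^ ncubes e` (two sub-unions of the event's cube set per event) and a share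
`φ e ≥ ncubes e · log 4`, the node count of any genealogy is at most `exp (nsum φ G)`. [folklore] -/
theorem ncount_cubes_le_exp_nsum (ncubes : ε → ℕ) (φ : ε → ℝ) (h : ∀ e, (ncubes e : ℝ) * Real.log 4 ≤ φ e)
    (G : Gen ε) : (ncount (fun e => 4 ^ ncubes e) G : ℝ) ≤ Real.exp (nsum φ G) :=
  ncount_le_exp_nsum _ φ (fun e => by simpa using four_pow_le_exp (h e)) G

/-- **A MEMBER's DECORATION SET COUNTED BY ITS GENEALOGY**: if the decoration set of a key member has at most
`ncount N w.2.1` elements and every event count is within its share, the member's count is within `exp (nsum φ w.2.1)` —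
the hypothesis `hcard` of `card_fibre_le_of_decoration`, member by member. [folklore] -/
theorem card_le_exp_nsum_of_le_ncount {γ δ' δ : Type*} (N : PEv → ℕ) (φ : PEv → ℝ)
    (h : ∀ e, (N e : ℝ) ≤ Real.exp (φ e)) {w : γ × Gen PEv × δ'} {D : Finset δ}
    (hD : D.card ≤ ncount N w.2.1) : (D.card : ℝ) ≤ Real.exp (nsum φ w.2.1) :=
  (Nat.cast_le.2 hD).trans (ncount_le_exp_nsum N φ h w.2.1)

/-- a product of per-event powers is within `exp` of the sum of per-event shares. [folklore] -/
theorem prod_pow_le_exp_sum (E : Finset ε) (n : ε → ℕ) (φ : ε → ℝ) (h : ∀ e ∈ E, (n e : ℝ) * Real.log 4 ≤ φ e) :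
    ∏ e ∈ E, (4 : ℝ) ^ n e ≤ Real.exp (∑ e ∈ E, φ e) := by
  rw [Real.exp_sum]
  exact Finset.prod_le_prod (fun _ _ => by positivity) fun e he => four_pow_le_exp (h e he)

end Counting

/-! ## §5 A decided toy: four terms over a one-member key, binary decoration, binary slice — `4 ≤ 2·2`, tight -/

section Toy

/-- toy terms `Bool × Bool` = (decoration bit, slice bit), all four in the fibre; key = one member `()`; decoration
`dec τ () := τ.1 ∈ univ`, slice `τ.2 ∈ univ` with envelope `v ≡ 1`, `W := 2`; unit weights.  The sliced lemma gives
`4 ≤ 2 · 2`. [folklore] -/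
theorem toy_sum_le : ∑ _τ ∈ (Finset.univ : Finset (Bool × Bool)), (1 : ℝ) ≤ 2 * ∏ _b ∈ ({()} : Finset Unit),
    ∑ _x ∈ (Finset.univ : Finset Bool), (1 : ℝ) :=
  sum_le_mul_prod_sum_of_sliced_decor (Finset.univ : Finset (Bool × Bool)) ({()} : Finset Unit)
    (fun _ => (Finset.univ : Finset Bool)) (fun τ _ => τ.1) (Finset.univ : Finset Bool) (fun τ => τ.2)
    (v := fun _ => (1 : ℝ)) (fun _ _ => zero_le_one) (W := 2) (by simp) (u := fun _ _ => (1 : ℝ))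
    (fun _ _ _ _ => zero_le_one) (fun _ _ => Finset.mem_univ _) (fun _ _ _ _ => Finset.mem_univ _)
    (fun τ _ τ' _ hs hd => Prod.ext (hd () (Finset.mem_singleton_self _)) hs) (fun _ _ => by simp)

/-- the toy is tight: both sides equal `4`. [folklore] -/
theorem toy_tight : ∑ _τ ∈ (Finset.univ : Finset (Bool × Bool)), (1 : ℝ) = 4 ∧
    2 * ∏ _b ∈ ({()} : Finset Unit), ∑ _x ∈ (Finset.univ : Finset Bool), (1 : ℝ) = 4 := by
  constructor
  · simp
  · simp
    norm_num

/-- the node count of a two-event toy genealogy (`born` then `renew`) with `4^1` choices at the birth and `1` at the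
renewal is `4`, within `exp (nsum φ)` at shares `(log 4, 0)`. [folklore] -/
theorem toy_ncount : ncount (fun e : PEv => if e.kind = 0 then 4 else 1)
    (Gen.renew (Gen.born ((0, 0, 1) : PEv) 0) ((1, 1, 0) : PEv) 0) = 4 := by
  simp [ncount, PEv.kind]

end Toy

end

end Summit.QuantumFields.BalabanUV.T4Continuum.HistoryBankingFibreResum
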